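import Summits.QuantumFields.QCD.Theorems.QuarksAsStableActionStableActionBridgeCyclicSupertrace
import Summits.QuantumFields.QCD.Theorems.QuarksAsStableActionStableActionBridgeAPTraceForm

/-!
# The thermal lattice-QCD Boltzmann integral as a cyclic kernel trace
(crux `QuarksAsStableAction.StableActionBridge`, item stmt-QuantumFields-9737, line `Sketch`;
registered stub `qcd_boltzmannAP_integral_eq_cyclic_trace`, the thermal (time-antiperiodic) twin of
capstone C `qcd_boltzmann_integral_eq_cyclic_supertrace` of the F3 dictionary)

For one flavour of `r = 1` Wilson quarks of bare mass `m > −1` in the fundamental representation of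
`SU(3)` on the four-torus `(ℤ/N)⁴` (`N ≥ 1`) with the time-ANTIPERIODIC boundary condition of
`QCDTimeReflection.wilsonDiracAP` (Montvay–Münster (4.34): antiperiodic Grassmann time computes the
honest thermal trace), the Boltzmann integral of lattice QCD over the product Haar measure of the
links,

  `Z_AP = ∫ e^{−β S_W(U)} det D_W^{AP}[U] ∏_e dU_e`,

equals the CYCLIC KERNEL TRACE of `N` projected transfer kernels: slicing the torus across Euclidean
time (spatial links `Us t`, temporal links `gs t` leaving slice `t`),

  `Z_AP = ∫∫ ∏_t K_β(Us t, (Us (t+1))^{gs t}) · Tr ∏_t T̂_F(Us t) Γ(G_{gs t}) ∏_t dUs_t ∏_t dgs_t`,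

with `K_β` the temporal-gauge transfer kernel of the gauge field (`gaugeSliceKernel`, Smit (4.121),
(4.129)), `T̂_F` Smit's fermionic transfer operator (`fermionSliceOp`, Smit (6.91)) and `Γ(G_g)` the
Fock-space gauge rotation (`fockGaugeAct`, Smit (4.125)–(4.127)).  NO gauge fixing is used: the
temporal links, put back as gauge transformations of the next slice and integrated against Haar, ARE
the Gauss-law projections `P̂₀` (Smit (4.137)), so this is the honest `Z_AP = Tr (𝕋 P̂₀)^N` at
kernel level (Lüscher 1977; Osterwalder–Seiler 1978 §2).

Assembly: the Yang–Mills time-slicing theorem `stub_timeSlicing` (the assembling map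
`(Us, gs) ↦ U` is measure preserving from the product of the slice Haar measures to the torus Haar
measure), the Boltzmann weight of the assembled field as the telescoped cyclic kernel product
(`CyclicSupertrace.exp_wilsonAction_timeAssemble`, boundary-condition independent), and the
antiperiodic capstone B `wilsonDiracAP_det_eq_trace_fermionSliceOp` (Montvay–Münster's trace
formula for `det D_W^{AP}`) read through the slicing dictionary; the integrand is continuous (the
antiperiodic Wilson–Dirac matrix is entrywise continuous in the links), so the integral is
transported along the assembling map (`integral_map`).  Pure theorem file (no definitions).

References: I. Montvay, G. Münster, *Quantum Fields on a Lattice* (CUP 1994), §4.1.3 (4.34)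
[MontvayMunster1994, §4.1.3 (4.34)]; M. Lüscher, Commun. Math. Phys. 54 (1977) 283
[Luscher1977, pp. 283–292]; K. Osterwalder, E. Seiler, Ann. Phys. 110 (1978) 440
[OsterwalderSeiler1978, §2]; J. Smit, *Introduction to Quantum Fields on a Lattice*
[Smit2023, §4.6 (4.127)–(4.137), §6.5 (6.87)–(6.91)].
-/

noncomputable section

namespace Summit.QuantumFields.QCD.Cruxes.StableActionBridge.Sketch

open MeasureTheory Matrix Literature.MathematicalPhysics.QuantumFieldTheory
  Literature.MathematicalPhysics.QuantumLattice
open Literature.Probability.LatticeModels (TorusSite)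

namespace CyclicTraceAP

/-- For a continuous representation `ρ` the time-ANTIPERIODIC Wilson–Dirac matrix
`D_W^{AP}(U, m, r)` depends continuously on the gauge field `U` (its entries are constants plus
finite sums of `ρ(U_e)_{ab}`, `ρ(U_e⁻¹)_{ab}` times fixed signs and spin matrices;
Montvay–Münster (4.85), (4.112)–(4.115), (5.5)). [folklore] -/
theorem continuous_wilsonDiracAP {L n : ℕ} {G : Type*} [Group G] [TopologicalSpace G]
    [IsTopologicalGroup G] (ρ : G →* Matrix (Fin n) (Fin n) ℂ) (hρ : Continuous ρ) (m r : ℝ) :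
    Continuous fun U : GaugeConfig 4 L G =>
      Literature.MathematicalPhysics.QuantumFieldTheory.wilsonDiracAP ρ U m r := by
  refine continuous_pi fun p => continuous_pi fun q => ?_
  simp only [Literature.MathematicalPhysics.QuantumFieldTheory.wilsonDiracAP, Matrix.of_apply]
  refine continuous_const.sub (continuous_const.mul (continuous_finsetSum _ fun μ _ => ?_))
  refine Continuous.add ?_ ?_
  · split_ifs
    · exact continuous_const.mul (continuous_const.mul
        ((hρ.comp (continuous_apply _)).matrix_elem _ _))
    · exact continuous_const
  · split_ifs
    · exact continuous_const.mul (continuous_const.mul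
        ((hρ.comp ((continuous_apply _).inv)).matrix_elem _ _))
    · exact continuous_const

/-- **The antiperiodic fermion determinant of the assembled field is the trace of the slice
data.**  For the four-torus field assembled from spatial slices `Us t` and temporal links `gs t`,
`det D_W^{AP} = Tr ∏_{i<N} T̂_F(Us i) Γ(G_{gs i})` (the antiperiodic capstone B read through the
slicing dictionary). [cite: MontvayMunster1994, §4.1.3 (4.34)] [cite: Luscher1977, pp. 283–292]
[cite: Smit2023, §6.5 (6.87)–(6.91)] -/
theorem det_wilsonDiracAP_timeAssemble (N : ℕ) [NeZero N]
    (Us : ZMod N → GaugeConfig 3 N (Matrix.specialUnitaryGroup (Fin 3) ℂ))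
    (gs : ZMod N → TorusSite 3 N → Matrix.specialUnitaryGroup (Fin 3) ℂ) (m : ℝ) (hm : -1 < m) :
    (Literature.MathematicalPhysics.QuantumFieldTheory.wilsonDiracAP (fundamentalRep (Fin 3))
        (fun e : Edge 4 N =>
          (Fin.cons (gs (e.1 0) (Fin.tail e.1)) (fun i : Fin 3 => Us (e.1 0) (Fin.tail e.1, i)) :
            Fin 4 → Matrix.specialUnitaryGroup (Fin 3) ℂ) e.2) m 1).det =
      (((List.range N).map fun i : ℕ =>
          fermionSliceOp (Us (i : ZMod N)) (fun _ : Fin 1 => m) *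
            fockGaugeAct (Nf := 1) (gs (i : ZMod N))).prod).trace := by
  rw [wilsonDiracAP_det_eq_trace_fermionSliceOp N _ m hm]
  simp only [Fin.cons_succ, Fin.cons_zero, Fin.tail_cons, Prod.mk.eta]

/-- **Pointwise identity behind the thermal capstone C.**  At the field assembled from
`p = (Us, gs)` the one-flavour thermal QCD Boltzmann integrand `e^{−β S_W(U)} det D_W^{AP}[U]` is
the cyclic kernel product times the trace of the time-ordered product of projected fermionic
transfer operators, `(∏_t K_β(Us t, (Us (t+1))^{gs t})) · Tr ∏_{i<N} T̂_F(Us i) Γ(G_{gs i})`.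
[cite: MontvayMunster1994, §4.1.3 (4.34)] [cite: Luscher1977, pp. 283–292]
[cite: Smit2023, §4.6 (4.127)–(4.137), §6.5 (6.87)–(6.91)] -/
theorem integrand_timeAssemble (N : ℕ) [NeZero N] (β m : ℝ) (hm : -1 < m)
    (p : (ZMod N → GaugeConfig 3 N (Matrix.specialUnitaryGroup (Fin 3) ℂ)) ×
      (ZMod N → TorusSite 3 N → Matrix.specialUnitaryGroup (Fin 3) ℂ)) :
    (Real.exp (-(β * wilsonAction (fundamentalRep (Fin 3))
        (fun e : Edge 4 N =>
          (Fin.cons (p.2 (e.1 0) (Fin.tail e.1)) (fun i : Fin 3 => p.1 (e.1 0) (Fin.tail e.1, i)) :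
            Fin 4 → Matrix.specialUnitaryGroup (Fin 3) ℂ) e.2))) : ℂ) *
        (Literature.MathematicalPhysics.QuantumFieldTheory.wilsonDiracAP (fundamentalRep (Fin 3))
          (fun e : Edge 4 N =>
            (Fin.cons (p.2 (e.1 0) (Fin.tail e.1)) (fun i : Fin 3 => p.1 (e.1 0) (Fin.tail e.1, i)) :
              Fin 4 → Matrix.specialUnitaryGroup (Fin 3) ℂ) e.2) m 1).det =
      ((∏ t : ZMod N, gaugeSliceKernel β (p.1 t) (gaugeTransform (p.2 t) (p.1 (t + 1))) : ℝ) : ℂ) *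
        (((List.range N).map fun i : ℕ =>
            fermionSliceOp (p.1 (i : ZMod N)) (fun _ : Fin 1 => m) *
              fockGaugeAct (Nf := 1) (p.2 (i : ZMod N))).prod).trace := by
  rw [CyclicSupertrace.exp_wilsonAction_timeAssemble N β p.1 p.2,
    det_wilsonDiracAP_timeAssemble N p.1 p.2 m hm]

/-- The one-flavour thermal QCD Boltzmann integrand `U ↦ e^{−β S_W(U)} det D_W^{AP}[U]` is
continuous on the compact configuration space `SU(3)^{edges}` (the Wilson action and the
antiperiodic Wilson–Dirac matrix are continuous in the links). [folklore] -/
theorem continuous_integrand (N : ℕ) [NeZero N] (β m : ℝ) :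
    Continuous fun U : GaugeConfig 4 N (Matrix.specialUnitaryGroup (Fin 3) ℂ) =>
      (Real.exp (-(β * wilsonAction (fundamentalRep (Fin 3)) U)) : ℂ) *
        (Literature.MathematicalPhysics.QuantumFieldTheory.wilsonDiracAP (fundamentalRep (Fin 3))
          U m 1).det :=
  (Complex.continuous_ofReal.comp (Real.continuous_exp.comp
    (((Literature.MathematicalPhysics.QuantumFieldTheory.continuous_wilsonAction
      (fundamentalRep (Fin 3)) (continuous_fundamentalRep (Fin 3))).const_mul β).neg))).mul
    (continuous_wilsonDiracAP (fundamentalRep (Fin 3)) (continuous_fundamentalRep (Fin 3)) m 1).matrix_det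

end CyclicTraceAP

/-- **Thermal capstone C of the F3 dictionary (stub `qcd_boltzmannAP_integral_eq_cyclic_trace` of
line `Sketch`): the thermal lattice-QCD Boltzmann integral is a cyclic kernel trace.**  For one
flavour of `r = 1` Wilson quarks of bare mass `m > −1` (fundamental representation of `SU(3)`) on
the four-torus `(ℤ/N)⁴` with time-ANTIPERIODIC boundary condition,
`∫ e^{−β S_W(U)} det D_W^{AP}[U] dU = ∫∫ ∏_t K_β(Us t, (Us (t+1))^{gs t}) · Tr ∏_t T̂_F(Us t) Γ(G_{gs t}) dUs dgs`:
the honest `Z_AP = Tr (𝕋 P̂₀)^N` at kernel level, without gauge fixing — the Haar integrals over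
the temporal links `gs t` are the Gauss-law projections `P̂₀`.
[cite: MontvayMunster1994, §4.1.3 (4.34)] [cite: Luscher1977, pp. 283–292]
[cite: OsterwalderSeiler1978, §2] [cite: Smit2023, §4.6 (4.127)–(4.137), §6.5 (6.87)–(6.91)] -/
theorem qcd_boltzmannAP_integral_eq_cyclic_trace : ∀ (N : ℕ) [NeZero N] (β m : ℝ), -1 < m → ∫ U : GaugeConfig 4 N (Matrix.specialUnitaryGroup (Fin 3) ℂ), (Real.exp (-(β * wilsonAction (fundamentalRep (Fin 3)) U)) : ℂ) * (Literature.MathematicalPhysics.QuantumFieldTheory.wilsonDiracAP (fundamentalRep (Fin 3)) U m 1).det ∂(Measure.pi fun _ : Edge 4 N => haarProbability (Matrix.specialUnitaryGroup (Fin 3) ℂ)) = ∫ p : (ZMod N → GaugeConfig 3 N (Matrix.specialUnitaryGroup (Fin 3) ℂ)) × (ZMod N → TorusSite 3 N → Matrix.specialUnitaryGroup (Fin 3) ℂ), ((∏ t : ZMod N, gaugeSliceKernel β (p.1 t) (gaugeTransform (p.2 t) (p.1 (t + 1))) : ℝ) : ℂ) * (((List.range N).map fun i : ℕ => fermionSliceOp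 (p.1 (i : ZMod N)) (fun _ : Fin 1 => m) * fockGaugeAct (Nf := 1) (p.2 (i : ZMod N))).prod).trace ∂((Measure.pi fun _ : ZMod N => Measure.pi fun _ : Edge 3 N => haarProbability (Matrix.specialUnitaryGroup (Fin 3) ℂ)).prod (Measure.pi fun _ : ZMod N => Measure.pi fun _ : TorusSite 3 N => haarProbability (Matrix.specialUnitaryGroup (Fin 3) ℂ))) := by
  intro N _ β m hm
  -- T1: the assembling map `(Us, gs) ↦ U` is measure preserving (slice Haar ↦ torus Haar)
  obtain ⟨hasm, -⟩ :=
    Summit.QuantumFields.YangMills.Theorems.WeakCouplingHypercubicLimit.TraceNormColdPressure.stub_timeSlicing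
      N (Matrix.specialUnitaryGroup (Fin 3) ℂ) (fundamentalRep (Fin 3))
  -- transport the torus integral along the assembling map
  rw [← hasm.map_eq, integral_map hasm.measurable.aemeasurable
    (CyclicTraceAP.continuous_integrand N β m).aestronglyMeasurable]
  -- and identify the integrands pointwise
  exact integral_congr_ae (ae_of_all _ fun p => CyclicTraceAP.integrand_timeAssemble N β m hm p)

end Summit.QuantumFields.QCD.Cruxes.StableActionBridge.Sketch

end
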